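import Summits.Schanuel.Schanuel.Theorems.RootDecomp1KTHLayerCell03

/-!
# RootDecomp1KTHLayerCell — lens 1, generation 40 «THE (T.H.) LAYER OF 33364: ORDER GRADING + LIOUVILLE TRANSCENDENCE-TYPE MEASURE + DIAZ RUNGS ON THE MOMENT CURVE» — continuation (RootDecomp1KTHLayerCell04): §5 Diaz rungs on the Liouville moment curve (mod `LargeTranscendenceDegree` BY NAME) + §6 the positive layer is not empty (`layers_proper`)

(lens-1 g40 `RootDecomp1KTHLayerCell.lean` [HOME/decomp-schanuel-lens-1/g40/ sha256 b5224e65…a9df, 1031 l; NODE L1861 / REQUEST L1862; critic VERDICT L1866 (CLEARED, ONE THEOREM credit, RULE K-R27, port GO)]; port by census-1 gen 17 as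
`RootDecomp1KTHLayerCell01`–`04` — see the PORT NOTE of part 01; `--supports stmt-Schanuel-33364`; rung 0.)
-/

noncomputable section

open Complex Polynomial IntermediateField Filter Asymptotics LiouvilleNumber
open scoped Nat Topology

namespace Summit.Schanuel.Schanuel.Theorems.RootDecomp1KTHLayer

open Summit.Schanuel.Schanuel.Theorems.RootDecomp1KHyper
open Summit.Schanuel.Schanuel.Theorems.RootDecomp1KHyper.HyperCell
open Summit.Schanuel.Schanuel.Theorems.RootDecomp1KGeneric (not_technicalHypothesis_of_hyperLinLiouville LiouvilleOrder)
open Summit.Schanuel.Schanuel.Theorems.RootDecomp1KFiniteOrderCell (zF ellF liouvilleOrder_ellF ellF_pos ellF_le_one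
  linearIndependent_zF linLiouville_zF not_hyperLinLiouville_zF zF_in_scope_33364)
open Summit.Schanuel.Schanuel.Theorems.RootDecomp1KTwoBaseCell (liouvilleNumber_le partialSum_pos')
open Literature.Barriers.Schanuel (TechnicalHypothesis LargeTranscendenceDegree gridField gridField₂ gridExp
  trdeg_mono one_le_of_add_lt_mul)

/-! ## §5 Diaz rungs on the Liouville moment curve (mod `LargeTranscendenceDegree`, BY NAME)

`hD : Literature.Barriers.Schanuel.LargeTranscendenceDegree` is Diaz's theorem (LNM 1752 Ch. 14 Thm 2.7, three
clauses), PROVED in the tree (`Literature.Barriers.Schanuel.LargeTranscendenceDegree_holds`); it is carried by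
name so that this kernel imports the lineage chain only. -/

section Diaz

variable {b : ℕ}

/-- `ℓ_b ∈ ℚ(zC b n, e^{zC b n})` (`n ≥ 1`). -/
theorem ell_mem_adjoin (b : ℕ) {n : ℕ} (hn : 1 ≤ n) :
    ((liouvilleNumber (b : ℝ) : ℝ) : ℂ) ∈
      IntermediateField.adjoin ℚ (Set.range (zC b n) ∪ Set.range (cexp ∘ zC b n)) := by
  refine IntermediateField.subset_adjoin _ _ (Set.mem_union_left _ ⟨⟨0, by omega⟩, ?_⟩)
  simp [zC]

/-- **The grid sits inside the cell.** For `x = zC b d = (ℓ_b, …, ℓ_b^d)`, `y = zK b l = (1, ℓ_b, …, ℓ_b^{l−1})`: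
`gridField₂ x y = ℚ(x, y, e^{ℓ_b^{i+1+j}}) ≤ ℚ(zC b n, e^{zC b n})`, `n = d + l − 1` (exponents
`1 ≤ i + 1 + j ≤ d + l − 1`). -/
theorem gridField₂_le_momentCurve (b : ℕ) {d l : ℕ} (hdl : l + d < d * l) :
    gridField₂ (zC b d) (zK b l) ≤
      IntermediateField.adjoin ℚ (Set.range (zC b (d + l - 1)) ∪ Set.range (cexp ∘ zC b (d + l - 1))) := by
  obtain ⟨hd1, hl1⟩ := one_le_of_add_lt_mul hdl
  have hℓ : ((liouvilleNumber (b : ℝ) : ℝ) : ℂ) ∈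
      IntermediateField.adjoin ℚ (Set.range (zC b (d + l - 1)) ∪ Set.range (cexp ∘ zC b (d + l - 1))) :=
    ell_mem_adjoin b (by omega)
  rw [Literature.Barriers.Schanuel.gridField₂]
  refine IntermediateField.adjoin_le_iff.mpr ?_
  rintro w ((⟨i, rfl⟩ | ⟨j, rfl⟩) | ⟨p, rfl⟩)
  · simp only [zC]; exact pow_mem hℓ _
  · simp only [zK]; exact pow_mem hℓ _
  · have hlt : (p.1 : ℕ) + (p.2 : ℕ) < d + l - 1 := by
      have h1 := p.1.is_lt; have h2 := p.2.is_lt; omega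
    refine IntermediateField.subset_adjoin _ _ (Set.mem_union_right _ ⟨⟨_, hlt⟩, ?_⟩)
    simp only [Function.comp, zC, zK]
    rw [← pow_add]
    congr 2
    omega

/-- The exponential part alone: `gridField x y = ℚ(e^{ℓ_b^k} : 1 ≤ k ≤ d + l − 1)`-subfield. -/
theorem gridField_le_expMomentCurve (b : ℕ) {d l : ℕ} (_hdl : l + d < d * l) :
    gridField (zC b d) (zK b l) ≤ IntermediateField.adjoin ℚ (Set.range (cexp ∘ zC b (d + l - 1))) := by
  rw [Literature.Barriers.Schanuel.gridField]
  refine IntermediateField.adjoin_le_iff.mpr ?_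
  rintro w ⟨p, rfl⟩
  have hlt : (p.1 : ℕ) + (p.2 : ℕ) < d + l - 1 := by
    have h1 := p.1.is_lt; have h2 := p.2.is_lt; omega
  refine IntermediateField.subset_adjoin _ _ ⟨⟨_, hlt⟩, ?_⟩
  simp only [Function.comp, zC, zK, Literature.Barriers.Schanuel.gridExp]
  rw [← pow_add]
  congr 2
  omega

/-- **DIAZ RUNG ON THE LIOUVILLE MOMENT CURVE (clause `t₂`).**  For `b ≥ 2` and `d + l < dl`:
`⌈dl/(d+l)⌉ ≤ trdeg_ℚ ℚ(ℓ_b, …, ℓ_bⁿ, e^{ℓ_b}, …, e^{ℓ_bⁿ})`, `n = d + l − 1` — a PROVED fraction of what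
33364 (hence Schanuel) demands on its cell `zC b n` (`n`), hypothesis-free modulo Diaz's theorem by name.
Inputs: freeness and (T.H.) of the power tuples of `ℓ_b` (§4, from the new measure §3).  The first value beyond
Theorem 2.9 (`dl ≥ 2(d+l)`, no (T.H.)) is `3` at `n = 8`. [cite: NesterenkoPhilippon2001, Ch. 14 Thm 2.7 (t₂)] -/
theorem diazRung_momentCurve (hD : LargeTranscendenceDegree) (hb : 2 ≤ b) {d l : ℕ} (hdl : l + d < d * l) :
    ((⌈((d * l : ℕ) : ℚ) / ((l + d : ℕ) : ℚ)⌉₊ : ℕ) : Cardinal) ≤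
      Algebra.trdeg ℚ ↥(IntermediateField.adjoin ℚ
        (Set.range (zC b (d + l - 1)) ∪ Set.range (cexp ∘ zC b (d + l - 1)))) :=
  (hD d l (zC b d) (zK b l) (linearIndependent_zC hb d) (technicalHypothesis_zC hb d)
    (linearIndependent_zK hb l) (technicalHypothesis_zK hb l) hdl).2.2.trans
      (trdeg_mono (gridField₂_le_momentCurve b hdl))

/-- **DIAZ RUNG, exponential side alone (clause `t`).**  `[dl/(d+l)] ≤ trdeg_ℚ ℚ(e^{ℓ_b}, e^{ℓ_b²}, …, e^{ℓ_bⁿ})`,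
`n = d + l − 1`. [cite: NesterenkoPhilippon2001, Ch. 14 Thm 2.7 (t)] -/
theorem diazRung_exp_momentCurve (hD : LargeTranscendenceDegree) (hb : 2 ≤ b) {d l : ℕ}
    (hdl : l + d < d * l) :
    (((d * l / (l + d) : ℕ)) : Cardinal) ≤
      Algebra.trdeg ℚ ↥(IntermediateField.adjoin ℚ (Set.range (cexp ∘ zC b (d + l - 1)))) :=
  (hD d l (zC b d) (zK b l) (linearIndependent_zC hb d) (technicalHypothesis_zC hb d)
    (linearIndependent_zK hb l) (technicalHypothesis_zK hb l) hdl).1.trans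
      (trdeg_mono (gridField_le_expMomentCurve b hdl))

/-- `(d, l) = (4, 5)`, `n = 8`: **`3 ≤ trdeg ℚ(ℓ_b^k, e^{ℓ_b^k} : 1 ≤ k ≤ 8)`** (`⌈20/9⌉ = 3`); 33364 demands `8`
(`sb_momentCurve_of_item`).  [cite: NesterenkoPhilippon2001, Ch. 14 Thm 2.7 (t₂)] -/
theorem three_le_trdeg_momentCurve_eight (hD : LargeTranscendenceDegree) (hb : 2 ≤ b) :
    ((3 : ℕ) : Cardinal) ≤ Algebra.trdeg ℚ ↥(IntermediateField.adjoin ℚ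
      (Set.range (zC b 8) ∪ Set.range (cexp ∘ zC b 8))) := by
  have h := diazRung_momentCurve hD hb (d := 4) (l := 5) (by norm_num)
  norm_num at h
  exact h

/-- `(d, l) = (6, 7)`, `n = 12`: **`4 ≤ trdeg ℚ(ℓ_b^k, e^{ℓ_b^k} : 1 ≤ k ≤ 12)`** (`⌈42/13⌉ = 4`); demand `12`.
[cite: NesterenkoPhilippon2001, Ch. 14 Thm 2.7 (t₂)] -/
theorem four_le_trdeg_momentCurve_twelve (hD : LargeTranscendenceDegree) (hb : 2 ≤ b) :
    ((4 : ℕ) : Cardinal) ≤ Algebra.trdeg ℚ ↥(IntermediateField.adjoin ℚ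
      (Set.range (zC b 12) ∪ Set.range (cexp ∘ zC b 12))) := by
  have h := diazRung_momentCurve hD hb (d := 6) (l := 7) (by norm_num)
  norm_num at h
  exact h

/-- `(d, l) = (6, 6)`, `n = 11`, exponential side: **three of `e^{ℓ_b}, e^{ℓ_b²}, …, e^{ℓ_b^{11}}` are
algebraically independent** (`[36/12] = 3`). [cite: NesterenkoPhilippon2001, Ch. 14 Thm 2.7 (t)] -/
theorem three_le_trdeg_exp_momentCurve_eleven (hD : LargeTranscendenceDegree) (hb : 2 ≤ b) :
    ((3 : ℕ) : Cardinal) ≤ Algebra.trdeg ℚ ↥(IntermediateField.adjoin ℚ (Set.range (cexp ∘ zC b 11))) := by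
  have h := diazRung_exp_momentCurve hD hb (d := 6) (l := 6) (by norm_num)
  norm_num at h
  exact h

/-- **Unbounded transcendence degree along the exponential moment curve**: for every `r` some
`e^{ℓ_b}, …, e^{ℓ_bⁿ}` contain `r` algebraically independent numbers (`d = l = 2r + 3`, `n = 4r + 5`).
Lindemann–Weierstrass is silent here (the exponents `ℓ_b^k` are transcendental). -/
theorem trdeg_exp_momentCurve_unbounded (hD : LargeTranscendenceDegree) (hb : 2 ≤ b) (r : ℕ) :
    (r : Cardinal) ≤ Algebra.trdeg ℚ ↥(IntermediateField.adjoin ℚ (Set.range (cexp ∘ zC b (4 * r + 5)))) := by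
  have hdl : (2 * r + 3) + (2 * r + 3) < (2 * r + 3) * (2 * r + 3) := by nlinarith
  have h := diazRung_exp_momentCurve hD hb hdl
  have hn : 2 * r + 3 + (2 * r + 3) - 1 = 4 * r + 5 := by omega
  rw [hn] at h
  have hr : r ≤ (2 * r + 3) * (2 * r + 3) / (2 * r + 3 + (2 * r + 3)) := by
    rw [Nat.le_div_iff_mul_le (by omega)]
    nlinarith
  exact le_trans (by exact_mod_cast hr) h

/-- The rung in the currency of the cell: what is PROVED (`⌈dl/(d+l)⌉`, mod `hD`) against what 33364 DEMANDS
(`d + l − 1`) on the same field, e.g. `3` of `8`, `4` of `12`, `⌈m(m+1)/(2m+1)⌉ ≈ n/4` of `n = 2m`. -/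
theorem rung_vs_demand (hD : LargeTranscendenceDegree) (hF : Item33364) (hb : 2 ≤ b) {d l : ℕ}
    (hdl : l + d < d * l) :
    ((⌈((d * l : ℕ) : ℚ) / ((l + d : ℕ) : ℚ)⌉₊ : ℕ) : Cardinal) ≤
      Algebra.trdeg ℚ ↥(IntermediateField.adjoin ℚ
        (Set.range (zC b (d + l - 1)) ∪ Set.range (cexp ∘ zC b (d + l - 1)))) ∧
    SB (d + l - 1) (zC b (d + l - 1)) := by
  obtain ⟨hd1, hl1⟩ := one_le_of_add_lt_mul hdl
  have h2 : 2 ≤ d + l - 1 := by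
    rcases Nat.lt_or_ge d 2 with hd | hd
    · interval_cases d; omega
    · omega
  exact ⟨diazRung_momentCurve hD hb hdl, sb_momentCurve_of_item hF hb h2⟩

end Diaz

/-! ## §6 The positive layer `F₊` is not empty: finite exponential order violates (T.H.)

A real `ρ ∈ (0, 1]` of exponential Liouville order `2` (`|ρ − p/q| < e^{−q²}` for arbitrarily large `q`;
tree `LiouvilleOrder`) gives on the moment curve `(ρ, ρ², …)` the integer form `qρ² − pρ = qρ(ρ − p/q)` of
height `≤ 2q` and size `< q·e^{−q²} ≤ e^{−2q}`: (T.H.) fails already at `ε = 1`.  The tree's tower-number cells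
`zF n` (gen 33, `RootDecomp1KFiniteOrderCell04`: order `7n + 3`, NOT hyper-Liouville, all three hypotheses of
33364 discharged) therefore lie in the scope of `F₊`: **the grading `F ⟺ F₊ ∧ F₀` is proper on both sides**,
and 3816 is silent on `F₊`. -/

section PositiveLayer

variable {b : ℕ}

/-- Exponential Liouville order `2` violates (T.H.) on the moment curve `(ρ, …, ρⁿ)`, `n ≥ 2`, `0 < ρ ≤ 1`. -/
theorem not_technicalHypothesis_momentCurve_of_liouvilleOrder_two {ρ : ℝ} (hρ : LiouvilleOrder 2 ρ)
    (hρ0 : 0 < ρ) (hρ1 : ρ ≤ 1) {n : ℕ} (hn : 2 ≤ n) :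
    ¬ TechnicalHypothesis (fun i : Fin n => ((ρ : ℝ) : ℂ) ^ ((i : ℕ) + 1)) := by
  obtain ⟨m, rfl⟩ : ∃ m, n = m + 2 := ⟨n - 2, by omega⟩
  intro hT
  obtain ⟨H₀, hH₀, hTH⟩ := hT 1 one_pos
  obtain ⟨r, hden, hne, hlt⟩ := hρ (max 3 ⌈H₀⌉₊)
  set q : ℕ := r.den with hq
  set p : ℤ := r.num with hp
  have hq3 : (3 : ℝ) ≤ q := by exact_mod_cast (le_max_left _ _).trans hden
  have hqH : H₀ ≤ q := (Nat.le_ceil H₀).trans (by exact_mod_cast (le_max_right _ _).trans hden)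
  have hq0 : (0 : ℝ) < q := by linarith
  have hr : (r : ℝ) = (p : ℝ) / q := by rw [hp, hq]; exact Rat.cast_def r
  -- the relation vector `h = (−p, q, 0, …, 0)`
  set h : Fin (m + 2) → ℤ := fun i => if (i : ℕ) = 0 then -p else if (i : ℕ) = 1 then (q : ℤ) else 0
    with hh
  have h0 : h 0 = -p := by rw [hh]; simp
  have h1 : h 1 = q := by rw [hh]; simp
  have h2 : ∀ i : Fin m, h i.succ.succ = 0 := fun i => by
    simp [hh, Fin.val_succ]
  have hne0 : h ≠ 0 := by
    intro h0'
    have h1' := congrFun h0' 1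
    rw [h1, Pi.zero_apply] at h1'
    have := r.den_pos
    omega
  -- the form `Σ h_i ρ^{i+1} = −pρ + qρ²`
  have hformC : ∑ i, (h i : ℂ) * ((ρ : ℝ) : ℂ) ^ ((i : ℕ) + 1) =
      ((-(p : ℝ) * ρ + (q : ℝ) * ρ ^ 2 : ℝ) : ℂ) := by
    rw [Fin.sum_univ_succ, Fin.sum_univ_succ]
    simp only [Fin.succ_zero_eq_one, h0, h1, h2, Int.cast_zero, zero_mul, Finset.sum_const_zero, add_zero,
      Fin.val_zero, Fin.val_one, zero_add, pow_one, Int.cast_neg, Int.cast_natCast]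
    push_cast
    ring
  have hformR : -(p : ℝ) * ρ + (q : ℝ) * ρ ^ 2 = q * ρ * (ρ - r) := by
    rw [hr]; field_simp; ring
  have hnorm : ‖∑ i, (h i : ℂ) * ((ρ : ℝ) : ℂ) ^ ((i : ℕ) + 1)‖ = q * ρ * |ρ - r| := by
    rw [hformC, Complex.norm_real, Real.norm_eq_abs, hformR, abs_mul, abs_mul, abs_of_pos hq0,
      abs_of_pos hρ0]
  -- heights `≤ 2q`
  have he1 : Real.exp (-((q : ℝ) ^ 2)) ≤ 1 := Real.exp_le_one_iff.mpr (by nlinarith)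
  have hr2 : |(r : ℝ)| < 2 := by
    have htri := abs_sub_abs_le_abs_sub (r : ℝ) ρ
    rw [abs_sub_comm] at htri
    have hρabs : |ρ| ≤ 1 := abs_le.mpr ⟨by linarith, hρ1⟩
    linarith
  have hp2 : |(p : ℝ)| < 2 * q := by
    rw [hr, abs_div, abs_of_pos hq0, div_lt_iff₀ hq0] at hr2
    exact hr2
  have hbound : ∀ i, |((h i : ℤ) : ℝ)| ≤ 2 * q := by
    intro i
    rcases Fin.eq_zero_or_eq_succ i with rfl | ⟨j, rfl⟩
    · rw [h0]; push_cast; rw [abs_neg]; exact hp2.le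
    · rcases Fin.eq_zero_or_eq_succ j with rfl | ⟨k, rfl⟩
      · rw [Fin.succ_zero_eq_one, h1]; push_cast; rw [Nat.abs_cast]; linarith
      · rw [h2 k]; simp
  -- (T.H.) at `ε = 1`, `H = 2q`
  have hT1 := hTH (2 * q) (by linarith) h hne0 hbound
  rw [Real.rpow_one, hnorm] at hT1
  -- `qρ|ρ − r| < q e^{−q²} ≤ e^{−2q}`
  have hsmall : (q : ℝ) * ρ * |ρ - r| < q * Real.exp (-((q : ℝ) ^ 2)) := by
    have h1' : (q : ℝ) * ρ * |ρ - r| ≤ q * |ρ - r| := by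
      have : (q : ℝ) * ρ ≤ q := by nlinarith
      exact mul_le_mul_of_nonneg_right this (abs_nonneg _)
    exact h1'.trans_lt (mul_lt_mul_of_pos_left hlt hq0)
  have hexp : (q : ℝ) * Real.exp (-((q : ℝ) ^ 2)) ≤ Real.exp (-(2 * (q : ℝ))) := by
    have hq' : (q : ℝ) ≤ (q : ℝ) ^ 2 - 2 * q + 1 := by nlinarith
    have he : (q : ℝ) ^ 2 - 2 * q + 1 ≤ Real.exp ((q : ℝ) ^ 2 - 2 * q) := Real.add_one_le_exp _
    calc (q : ℝ) * Real.exp (-((q : ℝ) ^ 2))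
        ≤ Real.exp ((q : ℝ) ^ 2 - 2 * q) * Real.exp (-((q : ℝ) ^ 2)) :=
          mul_le_mul_of_nonneg_right (hq'.trans he) (Real.exp_pos _).le
      _ = Real.exp (-(2 * (q : ℝ))) := by rw [← Real.exp_add]; ring_nf
  linarith

/-- **The tree's tower-number cells violate (T.H.):** `zF n` (`n ≥ 2`; `ℓ_F(n) = T_{7n+4}` of exponential
order `7n + 3 ≥ 2`, `0 < ℓ_F ≤ 1`). -/
theorem not_technicalHypothesis_zF {n : ℕ} (hn : 2 ≤ n) : ¬ TechnicalHypothesis (zF n) :=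
  not_technicalHypothesis_momentCurve_of_liouvilleOrder_two ((liouvilleOrder_ellF n).mono (by omega))
    (ellF_pos n) (ellF_le_one n) hn

/-- **`F₊`'s scope is not empty and contains gen 33's decided cells:** `zF n` (`n ≥ 2`) is ℚ-free,
`LinLiouville`, NOT `HyperLinLiouville` (tree `zF_in_scope_33364`, hypothesis-free) and violates (T.H.). -/
theorem zF_mem_posLayer_scope {n : ℕ} (hn : 2 ≤ n) :
    LinearIndependent ℚ (zF n) ∧ LinLiouville (zF n) ∧ ¬ HyperLinLiouville (zF n) ∧
      ¬ TechnicalHypothesis (zF n) :=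
  ⟨linearIndependent_zF n, linLiouville_zF hn, not_hyperLinLiouville_zF n, not_technicalHypothesis_zF hn⟩

/-- `F₊` decides `zF n`; (`F₀` and 3816 are silent there — their (T.H.) binder is violated). -/
theorem sb_zF_of_posLayer (hP : PosLayer) {n : ℕ} (hn : 2 ≤ n) : SB n (zF n) :=
  have h := zF_mem_posLayer_scope hn
  hP n _ h.1 h.2.1 h.2.2.1 h.2.2.2

/-- **The grading is PROPER on both sides** (hypothesis-free): for every `b ≥ 2`, `n ≥ 2` the Liouville moment
curve `zC b n` is in `F₀`'s scope and NOT in `F₊`'s, the tower curve `zF n` is in `F₊`'s scope and NOT in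
`F₀`'s — both inside 33364's scope. -/
theorem layers_proper (hb : 2 ≤ b) {n : ℕ} (hn : 2 ≤ n) :
    (LinearIndependent ℚ (zC b n) ∧ LinLiouville (zC b n) ∧ ¬ HyperLinLiouville (zC b n) ∧
      TechnicalHypothesis (zC b n)) ∧
    (LinearIndependent ℚ (zF n) ∧ LinLiouville (zF n) ∧ ¬ HyperLinLiouville (zF n) ∧
      ¬ TechnicalHypothesis (zF n)) :=
  ⟨momentCurve_mem_thLayer_scope hb hn, zF_mem_posLayer_scope hn⟩

end PositiveLayer

end Summit.Schanuel.Schanuel.Theorems.RootDecomp1KTHLayer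

end
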